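import Summits.AtomisticToContinuum.FouriersLaw.Theorems.OddSectorIrreversibilityTapLeakBoundMassiveTap
import Summits.AtomisticToContinuum.FouriersLaw.Theorems.OddSectorIrreversibilityTapLeakBoundGaussMoment
import Summits.AtomisticToContinuum.FouriersLaw.Theorems.OddSectorIrreversibilityTapLeakBoundParityNorm
import Summits.AtomisticToContinuum.FouriersLaw.Theorems.OddSectorIrreversibilityTapLeakBoundLocalMoment

/-!
# `TapLeakBound` (stmt-AtomisticToContinuum-15159), line `SketchIdeator2`: H1 from the one-sided mixed tap bound

Helper file (`--supports stmt-AtomisticToContinuum-15159`) for crux P = `OddSectorIrreversibility.TapLeakBound` (route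
`OddSectorIrreversibility`, sub-problem `FouriersLaw`). The route header's split is P ⇐ H1 ∧ C′ with
H1 = `BoundaryHermiteRegularity` (`‖𝒩_b u⁺‖²_{μ_T} ≤ C(|⟨u,J⟩| + Z)`, SECOND `p_b`-derivatives of the Kubo corrector,
`𝒩_b = -T∂²_{p_b} + p_b∂_{p_b}`) and C′ = `ResampledKickCone`; the glue `tapLeakBound_of_hermite_of_kickCone` is landed
(`…TapLeakBoundSplitGlue.lean`). Here H1 is REDUCED, with everything fixed-`N` kernel-checked, to ONE first-order,
one-sided `N`-uniform statement, the mixed tap bound `MixedTapBound` of crux idea card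
`drain-convexity-second-tap-identity` (`T∫ ∂_{q_b}u ∂_{p_b}u dμ_T ≤ C(|∫uJ dμ_T| + Z)`):

* `hermite_core` — at one `(N, b, u)`: from the landed massive tap inequality
  `γT‖∂²_{p_b}u‖² ≤ ⟨∂_bu, ∂_bJ⟩ + ⟨∂_bu, ∂_{q_b}u⟩` (`stub_massiveTap`, card friction-mass-tap-resolvent (★)), the tap
  identity `γT‖∂_bu‖² ≤ ⟨u,J⟩` (landed `tap_energy_identity`), the `N`-uniform local moment `‖∂_bJ‖² ≤ C_J Z`
  (`stub_localMoment`), the Gaussian bookkeeping `‖p_bf‖² ≤ 2T‖f‖² + 4T²‖∂_bf‖²` (`stub_gaussMoment`) and parity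
  `‖𝒩_bu⁺‖ ≤ ‖𝒩_bu‖` (`stub_parityNorm`): `‖𝒩_bu⁺‖² ≤ C_H(|⟨u,J⟩| + Z)` with
  `C_H = 10T²(K₁ + K₂) + 4/γ`, `K₁ = (γT)⁻¹((2γT)⁻¹ + C_M⁺/T)`, `K₂ = (γT)⁻¹(C_J⁺/2 + C_M⁺/T)`;
* `boundaryHermiteRegularity_of_mixedTapBound` — **MixedTapBound → H1** (both spelled in the route file's vocabulary);
* `tapLeakBound_of_mixedTapBound_of_kickCone` — **MixedTapBound → C′ → TapLeakBound** (conditional; the item is NOT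
  closed here: MixedTapBound and C′ are the two open `N`-uniform children of P).

References: folklore (Cauchy–Schwarz bookkeeping over landed identities).
-/

noncomputable section

open MeasureTheory ProbabilityTheory Filter Topology Set Function
open scoped NNReal ENNReal ContDiff

namespace Summit.AtomisticToContinuum.FouriersLaw.Theorems.OddSectorIrreversibility.TapLeak

open Literature.MathematicalPhysics.KineticTheory.HeatConduction
open Literature.MathematicalPhysics.KineticTheory
open Summit.AtomisticToContinuum.FouriersLaw.Theses.OddSectorIrreversibility (TapLeakBound)
open Summit.AtomisticToContinuum.FouriersLaw.Theorems.OddSectorWitness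
open Summit.AtomisticToContinuum.FouriersLaw.Theorems.OddSectorIrreversibility.Corrector

/-- `2√a√b ≤ a + b` for `a, b ≥ 0` (AM–GM). [folklore] -/
theorem two_mul_sqrt_mul_sqrt_le_add {a b : ℝ} (ha : 0 ≤ a) (hb : 0 ≤ b) :
    2 * (Real.sqrt a * Real.sqrt b) ≤ a + b := by
  have h := sq_nonneg (Real.sqrt a - Real.sqrt b)
  rw [sub_sq, Real.sq_sqrt ha, Real.sq_sqrt hb] at h
  linarith

section HermiteCore

variable {ω₂ lam β γ : ℝ} (hω : 0 < ω₂) (hl : 0 < lam) (hβ : 0 < β) (hγ : 0 < γ) {T : ℝ} (hT : 0 < T)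
include hω hl hβ hγ hT

/-- **H1 at one `(N, b, u)`, given the mixed tap bound and the local moment there.** With the constants `CM` of `stub_mixedTap` and `CJ` of
`stub_localMoment`: `𝒩_bu⁺ ∈ L²(μ_T)` and `‖𝒩_bu⁺‖² ≤ C_H(|⟨u,J⟩| + Z)` with
`C_H = 10T²(K₁ + K₂) + 4/γ`, `K₁ = (γT)⁻¹((2γT)⁻¹ + CM⁺/T)`, `K₂ = (γT)⁻¹(CJ⁺/2 + CM⁺/T)`. [folklore] -/
theorem hermite_core {CM CJ : ℝ} {N : ℕ} (b : Fin N) (hb : b.val = 0 ∨ b.val = N - 1)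
    {u : PhaseSpace N → ℝ} (hu1 : ContDiff ℝ 1 u) (hu2 : MemLp u 2 (gibbsWeight ω₂ lam β γ N T))
    (hlim : ∀ᵐ x ∂(gibbsWeight ω₂ lam β γ N T), Tendsto (fun τ : ℝ => ∫ t in Set.Ioc (0 : ℝ) τ,
        (∫ y, (∑ k : Fin N, (pinnedChain ω₂ lam β γ).bondCurrent N k y)
          ∂((pinnedChain ω₂ lam β γ).transitionKernel N T T t.toNNReal x))) atTop (𝓝 (u x)))
    (hM : MemLp (partialQ b u) 2 (gibbsWeight ω₂ lam β γ N T) ∧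
      T * ∫ x, partialQ b u x * partialP b u x ∂(gibbsWeight ω₂ lam β γ N T) ≤
        CM * (|∫ x, u x * (∑ k : Fin N, (pinnedChain ω₂ lam β γ).bondCurrent N k x) ∂(gibbsWeight ω₂ lam β γ N T)| +
          ∫ x, Real.exp (-((pinnedChain ω₂ lam β γ).hamiltonian N x) / T) ∂volume))
    (hJ : MemLp (partialP b (fun z : PhaseSpace N => ∑ k : Fin N, (pinnedChain ω₂ lam β γ).bondCurrent N k z)) 2
        (gibbsWeight ω₂ lam β γ N T) ∧
      ∫ x, (partialP b (fun z : PhaseSpace N => ∑ k : Fin N, (pinnedChain ω₂ lam β γ).bondCurrent N k z) x) ^ 2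
          ∂(gibbsWeight ω₂ lam β γ N T) ≤
        CJ * ∫ x, Real.exp (-((pinnedChain ω₂ lam β γ).hamiltonian N x) / T) ∂volume) :
    MemLp (fun x : PhaseSpace N => -(T * partialP b (partialP b (fun y : PhaseSpace N => (u y + u (y.1, -y.2)) / 2)) x) +
      x.2 b * partialP b (fun y : PhaseSpace N => (u y + u (y.1, -y.2)) / 2) x) 2 (gibbsWeight ω₂ lam β γ N T) ∧
    ∫ x, (-(T * partialP b (partialP b (fun y : PhaseSpace N => (u y + u (y.1, -y.2)) / 2)) x) +
        x.2 b * partialP b (fun y : PhaseSpace N => (u y + u (y.1, -y.2)) / 2) x) ^ 2 ∂(gibbsWeight ω₂ lam β γ N T) ≤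
      (10 * T ^ 2 * ((1 / (γ * T)) * (1 / (2 * γ * T) + max CM 0 / T) + (1 / (γ * T)) * (max CJ 0 / 2 + max CM 0 / T))
          + 4 / γ) *
        (|∫ x, u x * (∑ k : Fin N, (pinnedChain ω₂ lam β γ).bondCurrent N k x) ∂(gibbsWeight ω₂ lam β γ N T)| +
          ∫ x, Real.exp (-((pinnedChain ω₂ lam β γ).hamiltonian N x) / T) ∂volume) := by
  set P := pinnedChain ω₂ lam β γ with hP
  set μ := gibbsWeight ω₂ lam β γ N T with hμ
  set J : PhaseSpace N → ℝ := fun z => ∑ k : Fin N, P.bondCurrent N k z with hJdef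
  set Z : ℝ := ∫ x, Real.exp (-(P.hamiltonian N x) / T) ∂volume with hZ
  set A : ℝ := ∫ x, u x * J x ∂μ with hA
  set CM' : ℝ := max CM 0 with hCM'
  set CJ' : ℝ := max CJ 0 with hCJ'
  set K₁ : ℝ := (1 / (γ * T)) * (1 / (2 * γ * T) + CM' / T) with hK₁
  set K₂ : ℝ := (1 / (γ * T)) * (CJ' / 2 + CM' / T) with hK₂
  set v : PhaseSpace N → ℝ := partialP b u with hv
  set w : PhaseSpace N → ℝ := partialP b (partialP b u) with hw
  set Nu : PhaseSpace N → ℝ := fun x => -(T * w x) + x.2 b * v x with hNu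
  haveI : IsFiniteMeasure μ := isFiniteMeasure_gibbsWeight hω hl.le hβ.le γ N hT
  have hγT : 0 < γ * T := mul_pos hγ hT
  have hZ0 : 0 ≤ Z := integral_nonneg fun x => (Real.exp_pos _).le
  have hCM'0 : 0 ≤ CM' := le_max_right _ _
  have hCJ'0 : 0 ≤ CJ' := le_max_right _ _
  have hK₁0 : 0 ≤ K₁ := by positivity
  have hK₂0 : 0 ≤ K₂ := by positivity
  -- Step 1: `u` is the smooth corrector
  obtain ⟨hu, hpde⟩ := stub_correctorSmooth hω hl hβ hγ hT hu1.continuous hlim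
  have hu2c : ContDiff ℝ 2 u := hu.of_le (by norm_cast)
  have hv1 : ContDiff ℝ 1 v := contDiff_partialP hu2c (by norm_num) b
  -- Step 2: `L²` bookkeeping (`μ_T` vs `π_T`)
  have hJc : Continuous J := continuous_totalBondCurrent ω₂ lam β γ N
  have hϑ : 0 < 1 / (4 * T) := by positivity
  have h2ϑ : 2 * (1 / (4 * T)) < 1 / T := by
    rw [show 2 * (1 / (4 * T)) = 1 / (2 * T) by field_simp; ring, div_lt_div_iff₀ (by positivity) hT]
    nlinarith
  obtain ⟨M, -, hJM⟩ := abs_totalBondCurrent_le_exp hω.le hl.le hβ.le γ N hϑ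
  have hJ2π : MemLp J 2 (P.gibbsMeasure N T) := memLp_two_of_abs_le_exp hω hl.le hβ.le hT γ hJc h2ϑ hJM
  have hu2π : MemLp u 2 (P.gibbsMeasure N T) := memLp_gibbsMeasure_of_gibbsWeight hω hl.le hβ.le γ N hT hu2
  have hbw : 0 < OscillatorChain.bathWeight N b := by
    unfold OscillatorChain.bathWeight
    rcases hb with hb | hb
    · rw [if_pos hb]; split_ifs <;> norm_num
    · rw [if_pos hb]; split_ifs <;> norm_num
  have hvπ : MemLp v 2 (P.gibbsMeasure N T) := memLp_partialP_of_poisson hω hl.le hβ.le hγ hT hu2c hu2π hJ2π hpde hbw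
  have hv2 : MemLp v 2 μ := memLp_gibbsWeight_of_gibbsMeasure hω hl.le hβ.le γ N hT hvπ
  -- Step 3: the tap identity `γT‖∂_b u‖² ≤ ⟨u,J⟩`, `⟨u,J⟩ ≥ 0`
  have hN : 0 < N := b.pos
  set b₀ : Fin N := ⟨0, hN⟩ with hb₀def
  set b₁ : Fin N := ⟨N - 1, by omega⟩ with hb₁def
  have hb₀ : b₀.val = 0 := rfl
  have hb₁ : b₁.val = N - 1 := rfl
  have htap : γ * T * ((∫ x, partialP b₀ u x ^ 2 ∂μ) + ∫ x, partialP b₁ u x ^ 2 ∂μ) = A :=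
    tap_energy_identity hω hl.le hβ.le hγ hT hu2c hu2π hJc hJ2π hpde hb₀ hb₁
  have hI0 : 0 ≤ ∫ x, partialP b₀ u x ^ 2 ∂μ := integral_nonneg fun x => sq_nonneg _
  have hI1 : 0 ≤ ∫ x, partialP b₁ u x ^ 2 ∂μ := integral_nonneg fun x => sq_nonneg _
  have hA0 : 0 ≤ A := by rw [← htap]; positivity
  have hX : γ * T * ∫ x, (v x) ^ 2 ∂μ ≤ A := by
    have hsum : ∫ x, (v x) ^ 2 ∂μ ≤ (∫ x, partialP b₀ u x ^ 2 ∂μ) + ∫ x, partialP b₁ u x ^ 2 ∂μ := by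
      rcases hb with hb | hb
      · have e : b = b₀ := Fin.ext hb
        rw [hv, e]; linarith
      · have e : b = b₁ := Fin.ext hb
        rw [hv, e]; linarith
    calc γ * T * ∫ x, (v x) ^ 2 ∂μ ≤ γ * T * ((∫ x, partialP b₀ u x ^ 2 ∂μ) + ∫ x, partialP b₁ u x ^ 2 ∂μ) :=
          mul_le_mul_of_nonneg_left hsum hγT.le
      _ = A := htap
  have hX' : ∫ x, (v x) ^ 2 ∂μ ≤ A / (γ * T) := by
    rw [le_div_iff₀ hγT]; linarith
  -- Step 4: the two N-uniform inputs and the massive tap inequality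
  obtain ⟨hq2, hmix⟩ := hM
  obtain ⟨hJb2, hJle⟩ := hJ
  obtain ⟨hw2, hmass⟩ := stub_massiveTap hω hl.le hβ.le hγ hT b hb hu hpde hu2 hq2 hJb2
  -- Step 5: Gaussian bookkeeping and the norm of `𝒩_b u`
  obtain ⟨hpv2, hgauss⟩ := stub_gaussMoment (γ := γ) hω hl.le hβ.le hT b hv1 hv2 hw2
  have hNu2 : MemLp Nu 2 μ := ((hw2.const_mul T).neg).add hpv2
  have hNu_le : ∫ x, (Nu x) ^ 2 ∂μ ≤ 2 * T ^ 2 * ∫ x, (w x) ^ 2 ∂μ + 2 * ∫ x, (x.2 b * v x) ^ 2 ∂μ := by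
    have hR : Integrable (fun x => 2 * T ^ 2 * (w x) ^ 2 + 2 * (x.2 b * v x) ^ 2) μ :=
      (hw2.integrable_sq.const_mul (2 * T ^ 2)).add (hpv2.integrable_sq.const_mul 2)
    calc ∫ x, (Nu x) ^ 2 ∂μ ≤ ∫ x, (2 * T ^ 2 * (w x) ^ 2 + 2 * (x.2 b * v x) ^ 2) ∂μ := by
          refine integral_mono hNu2.integrable_sq hR fun x => ?_
          have h := sq_nonneg (T * w x + x.2 b * v x)
          simp only [hNu]
          nlinarith
      _ = 2 * T ^ 2 * ∫ x, (w x) ^ 2 ∂μ + 2 * ∫ x, (x.2 b * v x) ^ 2 ∂μ := by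
          rw [integral_add (hw2.integrable_sq.const_mul (2 * T ^ 2)) (hpv2.integrable_sq.const_mul 2),
            integral_const_mul, integral_const_mul]
  -- Step 6: parity
  obtain ⟨hNue2, hpar⟩ := stub_parityNorm (γ := γ) hω hl.le hβ.le hT b hu2c hNu2
  have hpar' : ∫ x, (-(T * partialP b (partialP b (fun y : PhaseSpace N => (u y + u (y.1, -y.2)) / 2)) x) +
      x.2 b * partialP b (fun y : PhaseSpace N => (u y + u (y.1, -y.2)) / 2) x) ^ 2 ∂μ ≤ ∫ x, (Nu x) ^ 2 ∂μ := hpar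
  suffices final : ∫ x, (Nu x) ^ 2 ∂μ ≤ (10 * T ^ 2 * (K₁ + K₂) + 4 / γ) * (|A| + Z) from ⟨hNue2, hpar'.trans final⟩
  -- Step 7: arithmetic (all integrals become real atoms; every step is linear)
  have hmass' : γ * T * ∫ x, (w x) ^ 2 ∂μ ≤ (∫ x, v x * partialP b J x ∂μ) + ∫ x, v x * partialQ b u x ∂μ := hmass
  have hgauss' : ∫ x, (x.2 b * v x) ^ 2 ∂μ ≤ 2 * T * ∫ x, (v x) ^ 2 ∂μ + 4 * T ^ 2 * ∫ x, (w x) ^ 2 ∂μ := hgauss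
  have h1 : ∫ x, v x * partialP b J x ∂μ ≤ (∫ x, (v x) ^ 2 ∂μ + ∫ x, (partialP b J x) ^ 2 ∂μ) / 2 := by
    have hcs := abs_integral_mul_le_sqrt hv2 hJb2
    have ham := two_mul_sqrt_mul_sqrt_le_add (a := ∫ x, (v x) ^ 2 ∂μ) (b := ∫ x, (partialP b J x) ^ 2 ∂μ)
      (integral_nonneg fun x => sq_nonneg (v x)) (integral_nonneg fun x => sq_nonneg (partialP b J x))
    have := le_abs_self (∫ x, v x * partialP b J x ∂μ)
    linarith
  have h2 : ∫ x, v x * partialQ b u x ∂μ ≤ CM' * (A + Z) / T := by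
    have e : ∫ x, v x * partialQ b u x ∂μ = ∫ x, partialQ b u x * partialP b u x ∂μ :=
      integral_congr_ae (Eventually.of_forall fun x => by simp only [hv]; ring)
    rw [e, le_div_iff₀ hT]
    have hAabs : |A| = A := abs_of_nonneg hA0
    have hmix' : T * ∫ x, partialQ b u x * partialP b u x ∂μ ≤ CM * (|A| + Z) := hmix
    have h3 : CM * (|A| + Z) ≤ CM' * (A + Z) := by
      rw [hAabs]; exact mul_le_mul_of_nonneg_right (le_max_left _ _) (add_nonneg hA0 hZ0)
    linarith
  have hJle' : ∫ x, (partialP b J x) ^ 2 ∂μ ≤ CJ' * Z :=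
    hJle.trans (mul_le_mul_of_nonneg_right (le_max_left _ _) hZ0)
  -- name the integrals
  generalize hXdef : ∫ x, (v x) ^ 2 ∂μ = X at hX' hgauss' h1
  generalize hYdef : ∫ x, (w x) ^ 2 ∂μ = Y at hmass' hgauss' hNu_le
  generalize hQdef : ∫ x, (x.2 b * v x) ^ 2 ∂μ = Q at hgauss' hNu_le
  generalize hVJdef : ∫ x, v x * partialP b J x ∂μ = VJ at hmass' h1
  generalize hVQdef : ∫ x, v x * partialQ b u x ∂μ = VQ at hmass' h2
  generalize hJJdef : ∫ x, (partialP b J x) ^ 2 ∂μ = JJ at hJle' h1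
  generalize hNNdef : ∫ x, (Nu x) ^ 2 ∂μ = NN at hNu_le ⊢
  rw [abs_of_nonneg hA0]
  -- `Y ≤ K₁ A + K₂ Z`
  have hY : Y ≤ K₁ * A + K₂ * Z := by
    have h4 : γ * T * Y ≤ (X + JJ) / 2 + CM' * (A + Z) / T := by linarith
    have h5 : γ * T * Y ≤ (A / (γ * T) + CJ' * Z) / 2 + CM' * (A + Z) / T := by linarith
    have h6 : Y ≤ ((A / (γ * T) + CJ' * Z) / 2 + CM' * (A + Z) / T) / (γ * T) := by
      rw [le_div_iff₀ hγT]; linarith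
    refine h6.trans (le_of_eq ?_)
    simp only [hK₁, hK₂]
    field_simp
    ring
  -- multiply the two bounds by their (nonnegative, non-numeral) coefficients by hand
  have hT2 : (0 : ℝ) ≤ 10 * T ^ 2 := by positivity
  have hYm : 10 * T ^ 2 * Y ≤ 10 * T ^ 2 * (K₁ * A + K₂ * Z) := mul_le_mul_of_nonneg_left hY hT2
  have hXm : 4 * T * X ≤ 4 * T * (A / (γ * T)) := mul_le_mul_of_nonneg_left hX' (by positivity)
  have h7 : 4 * T * (A / (γ * T)) = 4 / γ * A := by field_simp
  rw [h7] at hXm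
  have hfin : NN ≤ 10 * T ^ 2 * (K₁ * A + K₂ * Z) + 4 / γ * A := by linarith
  refine hfin.trans ?_
  have e : (10 * T ^ 2 * (K₁ + K₂) + 4 / γ) * (A + Z) - (10 * T ^ 2 * (K₁ * A + K₂ * Z) + 4 / γ * A) =
      10 * T ^ 2 * K₁ * Z + 10 * T ^ 2 * K₂ * A + 4 / γ * Z := by ring
  have hpos : 0 ≤ 10 * T ^ 2 * K₁ * Z + 10 * T ^ 2 * K₂ * A + 4 / γ * Z := by positivity
  linarith

end HermiteCore

/-- **MixedTapBound → H1 (`BoundaryHermiteRegularity`)** (`let`-free spelling over `gibbsWeight`; definitionally the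
route file's vocabulary): if for every parameter point there is `C_M` with `∂_{q_b}u ∈ L²(μ_T)` and
`T∫∂_{q_b}u ∂_{p_b}u dμ_T ≤ C_M(|∫uJ| + Z)` for the Kubo corrector `u` at each contact `b`, `N`-uniformly, then
`𝒩_bu⁺ ∈ L²(μ_T)` and `∫(𝒩_bu⁺)² dμ_T ≤ C(|∫uJ| + Z)` `N`-uniformly (`C = C_H(C_M, C_J)` of `hermite_core`, `C_J` from
the landed `stub_localMoment`). [folklore] -/
theorem boundaryHermiteRegularity_of_mixedTapBound :
    (∀ ω₂ lam β γ : ℝ, 0 < ω₂ → 0 < lam → 0 < β → 0 < γ → ∀ T : ℝ, 0 < T →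
      ∃ C : ℝ, ∀ (N : ℕ) (b : Fin N) (u : PhaseSpace N → ℝ), (b.val = 0 ∨ b.val = N - 1) →
        ContDiff ℝ 1 u → MemLp u 2 (gibbsWeight ω₂ lam β γ N T) →
        (∀ᵐ x ∂(gibbsWeight ω₂ lam β γ N T), Tendsto (fun τ : ℝ => ∫ t in Set.Ioc (0 : ℝ) τ,
            (∫ y, (∑ k : Fin N, (pinnedChain ω₂ lam β γ).bondCurrent N k y)
              ∂((pinnedChain ω₂ lam β γ).transitionKernel N T T t.toNNReal x))) atTop (𝓝 (u x))) →
          MemLp (partialQ b u) 2 (gibbsWeight ω₂ lam β γ N T) ∧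
          T * ∫ x, partialQ b u x * partialP b u x ∂(gibbsWeight ω₂ lam β γ N T) ≤
            C * (|∫ x, u x * (∑ k : Fin N, (pinnedChain ω₂ lam β γ).bondCurrent N k x) ∂(gibbsWeight ω₂ lam β γ N T)| +
              ∫ x, Real.exp (-((pinnedChain ω₂ lam β γ).hamiltonian N x) / T) ∂volume)) →
    ∀ ω₂ lam β γ : ℝ, 0 < ω₂ → 0 < lam → 0 < β → 0 < γ → ∀ T : ℝ, 0 < T →
      ∃ C : ℝ, ∀ (N : ℕ) (b : Fin N) (u : PhaseSpace N → ℝ), (b.val = 0 ∨ b.val = N - 1) →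
        ContDiff ℝ 1 u → MemLp u 2 (gibbsWeight ω₂ lam β γ N T) →
        (∀ᵐ x ∂(gibbsWeight ω₂ lam β γ N T), Tendsto (fun τ : ℝ => ∫ t in Set.Ioc (0 : ℝ) τ,
            (∫ y, (∑ k : Fin N, (pinnedChain ω₂ lam β γ).bondCurrent N k y)
              ∂((pinnedChain ω₂ lam β γ).transitionKernel N T T t.toNNReal x))) atTop (𝓝 (u x))) →
          MemLp (fun x : PhaseSpace N => -(T * partialP b (partialP b (fun y : PhaseSpace N => (u y + u (y.1, -y.2)) / 2)) x) +
            x.2 b * partialP b (fun y : PhaseSpace N => (u y + u (y.1, -y.2)) / 2) x) 2 (gibbsWeight ω₂ lam β γ N T) ∧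
          ∫ x, (-(T * partialP b (partialP b (fun y : PhaseSpace N => (u y + u (y.1, -y.2)) / 2)) x) +
              x.2 b * partialP b (fun y : PhaseSpace N => (u y + u (y.1, -y.2)) / 2) x) ^ 2 ∂(gibbsWeight ω₂ lam β γ N T) ≤
            C * (|∫ x, u x * (∑ k : Fin N, (pinnedChain ω₂ lam β γ).bondCurrent N k x) ∂(gibbsWeight ω₂ lam β γ N T)| +
              ∫ x, Real.exp (-((pinnedChain ω₂ lam β γ).hamiltonian N x) / T) ∂volume) := by
  intro hMix ω₂ lam β γ hω hl hβ hγ T hT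
  obtain ⟨CM, hM⟩ := hMix ω₂ lam β γ hω hl hβ hγ T hT
  obtain ⟨CJ, hJ⟩ := stub_localMoment ω₂ lam β γ hω hl.le hβ.le T hT
  refine ⟨10 * T ^ 2 * ((1 / (γ * T)) * (1 / (2 * γ * T) + max CM 0 / T) +
      (1 / (γ * T)) * (max CJ 0 / 2 + max CM 0 / T)) + 4 / γ, fun N b u hb hu1 hu2 hlim => ?_⟩
  exact hermite_core hω hl hβ hγ hT b hb hu1 hu2 hlim (hM N b u hb hu1 hu2 hlim) (hJ N b hb)

/-- **MixedTapBound → C′ (`ResampledKickCone`) → P (`TapLeakBound`)**: the crux follows, by name, from its two open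
`N`-uniform children through `boundaryHermiteRegularity_of_mixedTapBound` and the landed glue
`tapLeakBound_of_hermite_of_kickCone` (conditional result; the item is not closed here). [folklore] -/
theorem tapLeakBound_of_mixedTapBound_of_kickCone
    (hMix : ∀ ω₂ lam β γ : ℝ, 0 < ω₂ → 0 < lam → 0 < β → 0 < γ → ∀ T : ℝ, 0 < T →
      ∃ C : ℝ, ∀ (N : ℕ) (b : Fin N) (u : PhaseSpace N → ℝ), (b.val = 0 ∨ b.val = N - 1) →
        let P := pinnedChain ω₂ lam β γ
        let μT : Measure (PhaseSpace N) :=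
          volume.withDensity (fun x : PhaseSpace N => ENNReal.ofReal (Real.exp (-(P.hamiltonian N x) / T)))
        let J : PhaseSpace N → ℝ := fun z => ∑ k : Fin N, P.bondCurrent N k z
        ContDiff ℝ 1 u → MemLp u 2 μT →
        (∀ᵐ x ∂μT, Tendsto (fun τ : ℝ => ∫ t in Set.Ioc (0 : ℝ) τ,
            (∫ y, J y ∂(P.transitionKernel N T T t.toNNReal x))) atTop (𝓝 (u x))) →
          MemLp (partialQ b u) 2 μT ∧
          T * ∫ x, partialQ b u x * partialP b u x ∂μT ≤
            C * (|∫ x, u x * J x ∂μT| + ∫ x, Real.exp (-(P.hamiltonian N x) / T) ∂volume))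
    (hC : ∀ ω₂ lam β γ : ℝ, 0 < ω₂ → 0 < lam → 0 < β → 0 < γ → ∀ T : ℝ, 0 < T →
      ∃ a C : ℝ, 0 < a ∧ ∀ (N : ℕ) (i b : Fin N) (s : ℝ), (b.val = 0 ∨ b.val = N - 1) → 0 ≤ s →
        let P := pinnedChain ω₂ lam β γ
        let P₀ := pinnedChain ω₂ lam β 0
        let μT : Measure (PhaseSpace N) :=
          volume.withDensity (fun x : PhaseSpace N => ENNReal.ofReal (Real.exp (-(P.hamiltonian N x) / T)))
        let js : PhaseSpace N → ℝ := fun x => ∫ y, P.bondCurrent N i y ∂(P₀.transitionKernel N T T s.toNNReal x)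
        let d : ℕ := if b.val = 0 then i.val else N - 2 - i.val
        s ≤ a * (d : ℝ) →
          ∫ x, (∫ p', (js (x.1, Function.update x.2 b p') - js x) ^ 2 ∂(gaussianReal 0 (Real.toNNReal T))) ∂μT
            ≤ C * (∫ x, Real.exp (-(P.hamiltonian N x) / T) ∂volume) / (1 + ((d : ℝ) - s / a)) ^ 3) :
    TapLeakBound :=
  tapLeakBound_of_hermite_of_kickCone (boundaryHermiteRegularity_of_mixedTapBound hMix) hC

end Summit.AtomisticToContinuum.FouriersLaw.Theorems.OddSectorIrreversibility.TapLeak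

end
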